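import Mathlib
import HarnessLib
import Summits.PneNP.PneNP.Theorems.CnfIdealGenLengthRankDefectRepresentationsCutLemma
import Summits.PneNP.PneNP.Theorems.CnfIdealGenLengthRankDefectRepresentationsMergeLowerBound

/-!
# Crux `RankDefectRepresentations` (stmt-PneNP-18923), line `rank-dehn-ladder`, RESHAPE 17b:
# no colour-oblivious linear gluing rule is polynomial (`stub_obliviousNoGo`, brief g17 §W23)

A colour-oblivious LINEAR gluing rule for the SIM problem combines the data entrywise with weights
`α_m(σ,τ)` depending only on the row colour `σ` and the column colour `τ ∈ {0,1}^n`; with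
`β_m := α_m · 1[σ_m ≠ τ_m]` (matrices on colour space `Fin n → Bool`) the three hypotheses of the stub say:
`β_m` is supported on the `m`-cut pattern, `Σ_m β_m = 1` off the diagonal, and every pattern
`β_m ∘ 1[σ_k ≠ τ_k]` (`k ≠ m`), which controls the rule's error, has rank `≤ r`.  THEOREM
(`stub_obliviousNoGo`): then `2^n ≤ 16 n² r + 2` — every such rule is exponential.

Proof (memo `Lines/rank-dehn-ladder-g17.md` §3, brief §W23), all matrices `N × N`, `N := Fin n → Bool`:
1. CUT LEMMA PER `m` (`exists_split`): colour rows and columns of `β_m` by the punctured colour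
   `σ ↦ update σ m false`; every coordinate cut of `β_m` for this colouring has rank `≤ r` (the `m`-th one is
   zero), so the tree's max-cut decomposition + cut domination (`exists_nearDiagonal_of_cuts`, the proof of
   `…CutLemma.stub_cutLemma` with its constant `4` made explicit) give `S_m` supported on
   `{update σ m false = update τ m false}` with `rank (β_m − S_m) ≤ 4 n r`.  Put `L_m := β_m − S_m`.
2. `L_m` vanishes off the diagonal on each half `{σ_m = b}` (two distinct colours with the same `m`-th
   coordinate have distinct punctured colours), so `#{σ : L_m σσ ≠ 0} ≤ 2 rank L_m` (`card_le_rank`: a principal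
   submatrix that is diagonal with non-zero diagonal is invertible).
3. `M := Σ_m L_m` has `M στ = 1` for distinct `σ, τ` of the same PARITY (they differ in ≥ 2 coordinates, so every
   `S_m στ = 0`), hence on `{parity = c, M σσ ≠ 1}` the matrix `J − M` is invertible diagonal and
   `#{σ : parity σ = c, M σσ ≠ 1} ≤ rank M + 1` (`card_le_rank_add_one`, `rank J ≤ 1`).
4. COUNT: `2^n ≤ #{M σσ ≠ 0} + #{M σσ ≠ 1} ≤ Σ_m #{L_m σσ ≠ 0} + 2 (rank M + 1) ≤ 2·4n²r + 2·4n²r + 2`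
   (`rank M ≤ Σ_m rank L_m ≤ 4 n² r`).
HONEST FRAMING: elementary linear algebra on the hypercube; it says a polynomial SIM glue must be NON-LINEAR in
the data; it does not touch the item's deciding rung; P ≠ NP is not moved; F-N2 is a FRONTIER formal rung.
-/

set_option linter.dupNamespace false -- `Summit.PneNP.PneNP.…`: summit = sub-problem name (D-0017)

namespace Summit.PneNP.PneNP.Theorems.CnfIdealGenLengthRankDefectRepresentationsObliviousNoGo

open Finset Matrix Module
open Summit.PneNP.PneNP.Theorems.CnfIdealGenLengthRankDefectRepresentationsCutLemma
  (exists_blockDiagonal_of_maxCut rank_padBlock_eq)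
open Summit.PneNP.PneNP.Theorems.CnfIdealGenLengthRankDefectRepresentationsCutLemmaCutDominationMatrix
  (bipartitionCut_le_sum_coordinateCuts)
open Summit.PneNP.PneNP.Theorems.CnfIdealGenLengthRankDefectRepresentationsMergeLowerBound
  (rank_sub_le' rank_sum_le')

variable {K : Type} [Field K]

section DiagonalCounting

variable {N : Type} [Fintype N] [DecidableEq N]

/-- A square matrix whose off-diagonal entries vanish and whose diagonal entries are non-zero has full rank
(it is an invertible diagonal matrix). [folklore] -/
theorem rank_eq_card_of_offDiag_zero {T : Type} [Fintype T] [DecidableEq T] (A : Matrix T T K)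
    (hoff : ∀ i j, i ≠ j → A i j = 0) (hdiag : ∀ i, A i i ≠ 0) : A.rank = Fintype.card T := by
  have hA : A = Matrix.diagonal (fun i => A i i) := by
    ext i j
    by_cases h : i = j
    · subst h; rw [Matrix.diagonal_apply_eq]
    · rw [Matrix.diagonal_apply_ne _ h, hoff i j h]
  apply Matrix.rank_of_isUnit
  rw [Matrix.isUnit_iff_isUnit_det, hA, Matrix.det_diagonal]
  exact isUnit_iff_ne_zero.mpr (Finset.prod_ne_zero_iff.mpr fun i _ => hdiag i)

/-- If `L` vanishes at all off-diagonal cells of `s × s` and its diagonal entries on `s` are non-zero, then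
`#s ≤ rank L` (the principal submatrix on `s` is an invertible diagonal matrix). [folklore] -/
theorem card_le_rank (L : Matrix N N K) (s : Finset N)
    (hoff : ∀ σ ∈ s, ∀ τ ∈ s, σ ≠ τ → L σ τ = 0) (hdiag : ∀ σ ∈ s, L σ σ ≠ 0) :
    s.card ≤ L.rank := by
  have hT : (L.submatrix (Subtype.val : {σ // σ ∈ s} → N) (Subtype.val : {σ // σ ∈ s} → N)).rank =
      Fintype.card {σ // σ ∈ s} := by
    apply rank_eq_card_of_offDiag_zero
    · intro i j hij
      exact hoff i.1 i.2 j.1 j.2 (fun e => hij (Subtype.ext e))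
    · intro i; exact hdiag i.1 i.2
  rw [Fintype.card_coe] at hT
  rw [← hT]
  exact Matrix.rank_submatrix_le _ _ _

/-- If `M σ τ = 1` at all off-diagonal cells of `s × s` and `M σ σ ≠ 1` on `s`, then `#s ≤ rank M + 1`
(on `s × s`, `J − M` is an invertible diagonal matrix and `rank J ≤ 1`). [folklore] -/
theorem card_le_rank_add_one (M : Matrix N N K) (s : Finset N)
    (hone : ∀ σ ∈ s, ∀ τ ∈ s, σ ≠ τ → M σ τ = 1) (hdiag : ∀ σ ∈ s, M σ σ ≠ 1) :
    s.card ≤ M.rank + 1 := by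
  obtain ⟨M', hM'⟩ : ∃ M' : Matrix {σ // σ ∈ s} {σ // σ ∈ s} K,
      M' = M.submatrix Subtype.val Subtype.val := ⟨_, rfl⟩
  obtain ⟨J, hJ⟩ : ∃ J : Matrix {σ // σ ∈ s} {σ // σ ∈ s} K, J = Matrix.of fun _ _ => 1 := ⟨_, rfl⟩
  have hD : (J - M').rank = Fintype.card {σ // σ ∈ s} := by
    apply rank_eq_card_of_offDiag_zero
    · intro i j hij
      rw [hJ, hM', Matrix.sub_apply, Matrix.of_apply, Matrix.submatrix_apply,
        hone i.1 i.2 j.1 j.2 (fun e => hij (Subtype.ext e)), sub_self]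
    · intro i
      rw [hJ, hM', Matrix.sub_apply, Matrix.of_apply, Matrix.submatrix_apply]
      exact sub_ne_zero.mpr (Ne.symm (hdiag i.1 i.2))
  have hJr : J.rank ≤ 1 := by
    have e : J = Matrix.vecMulVec (fun _ => (1 : K)) (fun _ => (1 : K)) := by
      ext i j; simp [hJ, Matrix.vecMulVec_apply]
    rw [e]; exact Matrix.rank_vecMulVec_le _ _
  have hM'r : M'.rank ≤ M.rank := by rw [hM']; exact Matrix.rank_submatrix_le _ _ _
  have h := rank_sub_le' J M'
  rw [hD, Fintype.card_coe] at h
  omega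

end DiagonalCounting

section CutLemma

variable {ι ι' : Type} [Fintype ι] [Fintype ι'] [DecidableEq ι] [DecidableEq ι']

/-- **The cut lemma with its constant made explicit** (the proof of `…CutLemma.stub_cutLemma`, constants `C = 4`,
`a = 1`, without the slack factor `n + 1`): if every coordinate cut `R ∘ 1[row_j ≠ col_j]` has rank `≤ t`, then `R`
is within rank `4 n t` of a matrix supported on the equal-colour cells.  Max-cut decomposition
(`exists_blockDiagonal_of_maxCut`) + cut domination (`bipartitionCut_le_sum_coordinateCuts`). [folklore] -/
theorem exists_nearDiagonal_of_cuts {n : ℕ} (row : ι → Fin n → Bool) (col : ι' → Fin n → Bool) (t : ℕ)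
    (R : Matrix ι ι' K)
    (hcut : ∀ j : Fin n, (Matrix.of fun x y => if row x j ≠ col y j then R x y else 0).rank ≤ t) :
    ∃ R' : Matrix ι ι' K, (∀ x y, row x ≠ col y → R' x y = 0) ∧ (R - R').rank ≤ 4 * (n * t) := by
  classical
  obtain ⟨B, -, hB⟩ := Finset.exists_max_image (univ : Finset (Finset (Fin n → Bool)))
    (fun B' => (Matrix.of fun x y => if row x ∈ B' ∧ col y ∉ B' then R x y else 0).rank +
      (Matrix.of fun x y => if row x ∉ B' ∧ col y ∈ B' then R x y else 0).rank) univ_nonempty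
  obtain ⟨R', hsupp, hrank⟩ := exists_blockDiagonal_of_maxCut row col R B (fun B' => hB B' (mem_univ _))
  refine ⟨R', hsupp, hrank.trans ?_⟩
  have hdom := bipartitionCut_le_sum_coordinateCuts (K := K) row col R B
  rw [← rank_padBlock_eq row col R (fun σ => σ ∈ B) (fun σ => σ ∉ B),
    ← rank_padBlock_eq row col R (fun σ => σ ∉ B) (fun σ => σ ∈ B)] at hdom
  have hsum : ∑ j : Fin n, (Matrix.of fun x y => if row x j ≠ col y j then R x y else 0).rank ≤ n * t :=
    le_trans (Finset.sum_le_sum fun j _ => hcut j) (by simp)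
  exact Nat.mul_le_mul_left 4 (hdom.trans hsum)

end CutLemma

section Cube

variable {n : ℕ}

/-- Two colours with the same `m`-punctured colouring `σ ↦ update σ m false` agree at every `j ≠ m`. [folklore] -/
theorem apply_eq_of_update_eq {σ τ : Fin n → Bool} {m j : Fin n}
    (h : Function.update σ m false = Function.update τ m false) (hj : j ≠ m) : σ j = τ j := by
  have := congr_fun h j
  rwa [Function.update_of_ne hj, Function.update_of_ne hj] at this

/-- Two colours with the same `m`-punctured colouring and the same `m`-th coordinate are equal. [folklore] -/
theorem eq_of_update_eq_of_apply_eq {σ τ : Fin n → Bool} {m : Fin n}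
    (h : Function.update σ m false = Function.update τ m false) (hm : σ m = τ m) : σ = τ := by
  funext j
  by_cases hj : j = m
  · rw [hj]; exact hm
  · exact apply_eq_of_update_eq h hj

/-- Two colours with the same `m`-punctured colouring and the same PARITY `Σ_j σ_j (mod 2)` are equal
(a single flipped coordinate flips the parity). [folklore] -/
theorem eq_of_update_eq_of_parity_eq {σ τ : Fin n → Bool} {m : Fin n}
    (h : Function.update σ m false = Function.update τ m false)
    (hp : (∑ j, if σ j then (1 : ZMod 2) else 0) = ∑ j, if τ j then (1 : ZMod 2) else 0) : σ = τ := by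
  apply eq_of_update_eq_of_apply_eq h
  have hdiff : (∑ j, ((if σ j then (1 : ZMod 2) else 0) - (if τ j then (1 : ZMod 2) else 0))) =
      (if σ m then (1 : ZMod 2) else 0) - (if τ m then (1 : ZMod 2) else 0) := by
    apply Finset.sum_eq_single_of_mem m (mem_univ _)
    intro j _ hj
    rw [apply_eq_of_update_eq h hj, sub_self]
  rw [Finset.sum_sub_distrib, hp, sub_self] at hdiff
  have key : (if σ m then (1 : ZMod 2) else 0) = (if τ m then (1 : ZMod 2) else 0) :=
    (sub_eq_zero.mp hdiff.symm)
  revert key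
  cases σ m <;> cases τ m <;> simp

/-- **Step (1): the cut lemma per coordinate.**  If every pattern `β ∘ 1[σ_k ≠ τ_k]`, `k ≠ m`, has rank `≤ r`, then
`β = S + L` with `S` supported on the pairs with equal `m`-punctured colours (`σ△τ ⊆ {m}`) and `rank L ≤ 4 n r`:
the cut lemma for the colouring `σ ↦ update σ m false` (whose `m`-th coordinate cut is zero). [folklore] -/
theorem exists_split (r : ℕ) (β : Matrix (Fin n → Bool) (Fin n → Bool) K) (m : Fin n)
    (h3 : ∀ k, m ≠ k → (Matrix.of fun σ τ : Fin n → Bool => if σ k ≠ τ k then β σ τ else 0).rank ≤ r) :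
    ∃ S : Matrix (Fin n → Bool) (Fin n → Bool) K,
      (∀ σ τ, Function.update σ m false ≠ Function.update τ m false → S σ τ = 0) ∧
      (β - S).rank ≤ 4 * (n * r) := by
  apply exists_nearDiagonal_of_cuts (fun σ : Fin n → Bool => Function.update σ m false)
    (fun τ : Fin n → Bool => Function.update τ m false) r β
  intro j
  by_cases hj : j = m
  · have e : (Matrix.of fun σ τ : Fin n → Bool =>
        if Function.update σ m false j ≠ Function.update τ m false j then β σ τ else 0) = 0 := by
      ext σ τ; simp [hj]
    rw [e, Matrix.rank_zero]; exact Nat.zero_le _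
  · have e : (Matrix.of fun σ τ : Fin n → Bool =>
        if Function.update σ m false j ≠ Function.update τ m false j then β σ τ else 0) =
        Matrix.of fun σ τ : Fin n → Bool => if σ j ≠ τ j then β σ τ else 0 := by
      ext σ τ; simp [hj]
    rw [e]; exact h3 j (Ne.symm hj)

/-- **NO COLOUR-OBLIVIOUS LINEAR GLUING RULE IS POLYNOMIAL** (registered stub `stub_obliviousNoGo` of line
`rank-dehn-ladder`, RESHAPE 17b, crux stmt-PneNP-18923).  If matrices `β_m` on colour space `{0,1}^n` are supported on
the `m`-cut patterns (`σ_m = τ_m → β_m στ = 0`), sum to `1` off the diagonal, and every pattern `β_m ∘ 1[σ_k ≠ τ_k]`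
(`k ≠ m`) has rank `≤ r`, then `2^n ≤ 16 n² r + 2`.  Proof: module docstring (cut lemma per coordinate, diagonal halves,
parity classes, counting). -/
theorem stub_obliviousNoGo :
    ∀ (K : Type) [Field K] (n r : ℕ) (β : Fin n → Matrix (Fin n → Bool) (Fin n → Bool) K),
      (∀ m σ τ, σ m = τ m → β m σ τ = 0) →
      (∀ σ τ, σ ≠ τ → ∑ m, β m σ τ = 1) →
      (∀ m k, m ≠ k → (Matrix.of fun σ τ => if σ k ≠ τ k then β m σ τ else 0).rank ≤ r) →
      2 ^ n ≤ 16 * n ^ 2 * r + 2 := by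
  intro K _ n r β h1 h2 h3
  classical
  -- Step (1): split every `β m = S m + L m`.
  choose S hS hrank using fun m => exists_split r (β m) m (h3 m)
  obtain ⟨L, hL⟩ : ∃ L : Fin n → Matrix (Fin n → Bool) (Fin n → Bool) K, L = fun m => β m - S m := ⟨_, rfl⟩
  obtain ⟨M, hM⟩ : ∃ M : Matrix (Fin n → Bool) (Fin n → Bool) K, M = ∑ m, L m := ⟨_, rfl⟩
  obtain ⟨par, hpar⟩ : ∃ par : (Fin n → Bool) → ZMod 2,
      par = fun σ => ∑ j, if σ j then (1 : ZMod 2) else 0 := ⟨_, rfl⟩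
  have hLrank : ∀ m, (L m).rank ≤ 4 * (n * r) := fun m => by rw [hL]; exact hrank m
  -- Step (2): `L m` vanishes off the diagonal on each `m`-half, so few diagonal entries of `L m` are non-zero.
  have hLoff : ∀ m σ τ, σ m = τ m → σ ≠ τ → L m σ τ = 0 := by
    intro m σ τ hst hne
    rw [hL]
    change β m σ τ - S m σ τ = 0
    rw [h1 m σ τ hst, hS m σ τ (fun e => hne (eq_of_update_eq_of_apply_eq e hst)), sub_zero]
  have hLhalf : ∀ m (b : Bool), (univ.filter (fun σ => σ m = b ∧ L m σ σ ≠ 0)).card ≤ (L m).rank := by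
    intro m b
    apply card_le_rank
    · intro σ hσ τ hτ hne
      simp only [Finset.mem_filter, Finset.mem_univ, true_and] at hσ hτ
      exact hLoff m σ τ (hσ.1.trans hτ.1.symm) hne
    · intro σ hσ
      simp only [Finset.mem_filter, Finset.mem_univ, true_and] at hσ
      exact hσ.2
  have hLcount : ∀ m, (univ.filter (fun σ => L m σ σ ≠ 0)).card ≤ 2 * (L m).rank := by
    intro m
    have hsub : univ.filter (fun σ => L m σ σ ≠ 0) ⊆
        univ.filter (fun σ => σ m = true ∧ L m σ σ ≠ 0) ∪
          univ.filter (fun σ => σ m = false ∧ L m σ σ ≠ 0) := by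
      intro σ hσ
      simp only [Finset.mem_filter, Finset.mem_union, Finset.mem_univ, true_and] at hσ ⊢
      cases σ m <;> simp [hσ]
    have ht := hLhalf m true
    have hf := hLhalf m false
    exact (Finset.card_le_card hsub).trans ((Finset.card_union_le _ _).trans (by omega))
  -- Step (3): the diagonal of `M = Σ_m L m`.
  have hMdiag : ∀ σ, M σ σ = ∑ m, L m σ σ := by
    intro σ; rw [hM, Matrix.sum_apply]
  have hcount0 : (univ.filter (fun σ => M σ σ ≠ 0)).card ≤
      ∑ m, (univ.filter (fun σ => L m σ σ ≠ 0)).card := by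
    have hsub : univ.filter (fun σ => M σ σ ≠ 0) ⊆
        univ.biUnion (fun m => univ.filter (fun σ => L m σ σ ≠ 0)) := by
      intro σ hσ
      simp only [Finset.mem_filter, Finset.mem_univ, true_and] at hσ
      rw [hMdiag] at hσ
      obtain ⟨m, -, hm⟩ := Finset.exists_ne_zero_of_sum_ne_zero hσ
      simp only [Finset.mem_biUnion, Finset.mem_univ, Finset.mem_filter, true_and]
      exact ⟨m, hm⟩
    exact (Finset.card_le_card hsub).trans Finset.card_biUnion_le
  -- Off the diagonal, inside a parity class, `M = 1`.
  have hMone : ∀ σ τ, σ ≠ τ → par σ = par τ → M σ τ = 1 := by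
    intro σ τ hne hp
    rw [hpar] at hp
    have hSz : ∀ m, S m σ τ = 0 :=
      fun m => hS m σ τ (fun e => hne (eq_of_update_eq_of_parity_eq e hp))
    have e : M σ τ = ∑ m, β m σ τ := by
      rw [hM, Matrix.sum_apply]
      refine Finset.sum_congr rfl fun m _ => ?_
      rw [hL]
      change β m σ τ - S m σ τ = β m σ τ
      rw [hSz m, sub_zero]
    rw [e]; exact h2 σ τ hne
  -- Step (4): the two parity classes.
  have hclass : ∀ c : ZMod 2, (univ.filter (fun σ => par σ = c ∧ M σ σ ≠ 1)).card ≤ M.rank + 1 := by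
    intro c
    apply card_le_rank_add_one
    · intro σ hσ τ hτ hne
      simp only [Finset.mem_filter, Finset.mem_univ, true_and] at hσ hτ
      exact hMone σ τ hne (hσ.1.trans hτ.1.symm)
    · intro σ hσ
      simp only [Finset.mem_filter, Finset.mem_univ, true_and] at hσ
      exact hσ.2
  have hcount1 : (univ.filter (fun σ => M σ σ ≠ 1)).card ≤ 2 * M.rank + 2 := by
    have hsub : univ.filter (fun σ => M σ σ ≠ 1) ⊆
        univ.filter (fun σ => par σ = 0 ∧ M σ σ ≠ 1) ∪ univ.filter (fun σ => par σ = 1 ∧ M σ σ ≠ 1) := by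
      intro σ hσ
      simp only [Finset.mem_filter, Finset.mem_union, Finset.mem_univ, true_and] at hσ ⊢
      by_cases hp : par σ = 0
      · exact Or.inl ⟨hp, hσ⟩
      · have hx : ∀ x : ZMod 2, x ≠ 0 → x = 1 := by decide
        exact Or.inr ⟨hx _ hp, hσ⟩
    have h0 := hclass 0
    have h1' := hclass 1
    exact (Finset.card_le_card hsub).trans ((Finset.card_union_le _ _).trans (by omega))
  -- Step (5): counting.
  have htotal : 2 ^ n ≤ (univ.filter (fun σ => M σ σ ≠ 0)).card + (univ.filter (fun σ => M σ σ ≠ 1)).card := by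
    have hcard : Fintype.card (Fin n → Bool) = 2 ^ n := by simp
    rw [← hcard, ← Finset.card_univ]
    have hsub : (univ : Finset (Fin n → Bool)) ⊆
        univ.filter (fun σ => M σ σ ≠ 0) ∪ univ.filter (fun σ => M σ σ ≠ 1) := by
      intro σ _
      simp only [Finset.mem_union, Finset.mem_filter, Finset.mem_univ, true_and]
      by_cases h : M σ σ = 1
      · exact Or.inl (by rw [h]; exact one_ne_zero)
      · exact Or.inr h
    exact (Finset.card_le_card hsub).trans (Finset.card_union_le _ _)
  have hMrank : M.rank ≤ n * (4 * (n * r)) := by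
    rw [hM]
    refine (rank_sum_le' (univ : Finset (Fin n)) L).trans ?_
    exact le_trans (Finset.sum_le_sum fun m _ => hLrank m) (by simp)
  have hLsum : ∑ m, (univ.filter (fun σ => L m σ σ ≠ 0)).card ≤ n * (2 * (4 * (n * r))) := by
    refine le_trans (Finset.sum_le_sum fun m _ => (hLcount m).trans (Nat.mul_le_mul_left 2 (hLrank m))) ?_
    simp
  have hfin : 2 ^ n ≤ n * (2 * (4 * (n * r))) + (2 * (n * (4 * (n * r))) + 2) :=
    htotal.trans (Nat.add_le_add (hcount0.trans hLsum)
      (hcount1.trans (Nat.add_le_add_right (Nat.mul_le_mul_left 2 hMrank) 2)))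
  have e : n * (2 * (4 * (n * r))) + (2 * (n * (4 * (n * r))) + 2) = 16 * n ^ 2 * r + 2 := by ring
  rw [e] at hfin
  exact hfin

end Cube

end Summit.PneNP.PneNP.Theorems.CnfIdealGenLengthRankDefectRepresentationsObliviousNoGo
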